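import Literature.AnabelianGeometry.SemiGraphs.Prop36HypothesesWitnessLevelDictionary
import HarnessLib

/-!
# Non-vacuity of the v1 per-level branch dictionary `ProfiniteSemiGraph.LevelDictionary` (L3 inhabitation census)

PROOF-ONLY companion (abc-iut cell, layer L3, row «NV-L3 LevelDictionary v1», abc-iut-L3-lead gen 5 ruling
α51 (2); writer abc-iut-w6-d050).  abc-iut-L3-t11's `LevelDictionary 𝒢 c` (`TemperedLevelDictionary.lean`,
[SemiAnbd] Rmk. 2.2.1 p. 24 / Def. 2.2 (i) p. 23 packaging) had ZERO producers in abc-iut-w4-d098's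
INHABITATION-CENSUS-L3 v2.  Its three kernel fields `isOpen_ker_qAct / ker_qAct_anti / ker_qAct_trivial` ask the
compact overgroup `Q` to act on the finite LEVEL GRAPHS `𝔾_j` with open, antitone kernels MEETING IN `1` — which
fails whenever all `𝔾_j` are points and `Q ≠ 1` (abc-iut-L3-t10, `TemperedLevelDictionaryCov.lean`; the repaired
`CovLevelDictionary` carries the covering kernels `M_j` instead and is inhabited by
`affCovLevelDictionary`).  This file shows the v1 interface is nevertheless CONSISTENT: at abc-iut-w5-d040 /
abc-iut-L3-t9's witness `affWitness p` (one vertex with group `Aff(ℤ_p)`, no edges) over the explicit chart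
`affChart p` (`π₁^temp = Aff(ℤ_p)`), take the tree-level data of `affCovLevelDictionary` (point trees, trivial
actions) and as level graph `𝔾_j` the EDGELESS semi-graph on `{⋆} ⊔ Aff(ℤ_p)/Γ_j` (`Γ_j` the congruence
subgroups), with `Q := Aff(ℤ_p)` acting trivially on `⋆` and by left translation on `Aff(ℤ_p)/Γ_j`; the
universal graph-covering `𝒢_{∞,j} → 𝔾_j` is the point `↦ ⋆` (an immersion), the transitions are the
projections `Aff(ℤ_p)/Γ_j → Aff(ℤ_p)/Γ_i`, and `ker (Q → Aut 𝔾_j) = Γ_j` (normal), open, antitone, `⋂_j Γ_j = 1`.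
Every axiom of the structure is discharged; no statement of [SemiAnbd] is asserted; the four obligations
(DV)–(DN) are NOT claimed for this instance (they concern the intended coverings).  No `def`, no `instance`:
the witness is built inside the proof of `nonempty_levelDictionary_affChart`.  Nothing here takes a side on
[IUTchIII] Cor. 3.12; typed ≠ proved.
-/

noncomputable section

namespace Literature.AnabelianGeometry.SemiGraphs

namespace ProfiniteSemiGraph

open CategoryTheory Topology Literature.GroupTheory.SpecificGroups


/-! ### Generic bookkeeping on `{⋆} ⊔ G/H` (kept abstract so that the kernel never unfolds the concrete group) -/

section Generic

variable {G : Type*} [Group G]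

/-- `1` acts trivially on `{⋆} ⊔ G/H`. [folklore] -/
private theorem sumMap_smul_one (H : Subgroup G) :
    Sum.map (id : Unit → Unit) (fun x : G ⧸ H => (1 : G) • x) = id := by
  funext x; rcases x with x | x
  · rfl
  · simp

/-- The translation action on `{⋆} ⊔ G/H` is multiplicative. [folklore] -/
private theorem sumMap_smul_mul (H : Subgroup G) (a b : G) :
    Sum.map (id : Unit → Unit) (fun x : G ⧸ H => (a * b) • x) =
      Sum.map id (fun x : G ⧸ H => a • x) ∘ Sum.map id (fun x : G ⧸ H => b • x) := by
  funext x; rcases x with x | x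
  · rfl
  · simp [mul_smul]

/-- The projection `{⋆} ⊔ G/H → {⋆} ⊔ G/H` along `H ≤ H` is the identity. [folklore] -/
private theorem sumMap_quotientMapOfLE_refl (H : Subgroup G) :
    Sum.map (id : Unit → Unit) (Subgroup.quotientMapOfLE (le_refl H)) = id := by
  funext x; rcases x with x | x
  · rfl
  · induction x using QuotientGroup.induction_on with
    | H y => simp only [Sum.map_inr, Subgroup.quotientMapOfLE_apply_mk, id_eq]

/-- The projections `{⋆} ⊔ G/H → {⋆} ⊔ G/K → {⋆} ⊔ G/L` compose (`H ≤ K ≤ L`). [folklore] -/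
private theorem sumMap_quotientMapOfLE_comp {H K L : Subgroup G} (hHK : H ≤ K) (hKL : K ≤ L) :
    Sum.map (id : Unit → Unit) (Subgroup.quotientMapOfLE hKL) ∘ Sum.map id (Subgroup.quotientMapOfLE hHK) =
      Sum.map id (Subgroup.quotientMapOfLE (hHK.trans hKL)) := by
  funext x; rcases x with x | x
  · rfl
  · induction x using QuotientGroup.induction_on with
    | H y => simp only [Function.comp_apply, Sum.map_inr, Subgroup.quotientMapOfLE_apply_mk]

/-- The projections `{⋆} ⊔ G/H → {⋆} ⊔ G/K` are equivariant for the translation actions. [folklore] -/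
private theorem sumMap_quotientMapOfLE_smul {H K : Subgroup G} (h : H ≤ K) (q : G) :
    Sum.map (id : Unit → Unit) (Subgroup.quotientMapOfLE h) ∘ Sum.map id (fun x : G ⧸ H => q • x) =
      Sum.map id (fun x : G ⧸ K => q • x) ∘ Sum.map id (Subgroup.quotientMapOfLE h) := by
  funext x; rcases x with x | x
  · rfl
  · induction x using QuotientGroup.induction_on with
    | H y => simp only [Function.comp_apply, Sum.map_inr, MulAction.Quotient.smul_coe,
        Subgroup.quotientMapOfLE_apply_mk]

/-- A NORMAL subgroup acts trivially on its own coset space. [folklore] -/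
private theorem smul_quotient_eq_self_of_mem (H : Subgroup G) [H.Normal] {q : G} (hq : q ∈ H) (x : G ⧸ H) :
    q • x = x := by
  induction x using QuotientGroup.induction_on with
  | H y =>
    rw [MulAction.Quotient.smul_coe, QuotientGroup.eq]
    have : y⁻¹ * q⁻¹ * y ∈ H := Subgroup.Normal.conj_mem' inferInstance q⁻¹ (H.inv_mem hq) y
    simpa [smul_eq_mul, mul_assoc] using this

/-- An element fixing the coset `1·H` lies in `H`. [folklore] -/
private theorem mem_of_smul_mk_one_eq (H : Subgroup G) {q : G}
    (h : q • ((1 : G) : G ⧸ H) = ((1 : G) : G ⧸ H)) : q ∈ H := by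
  rw [MulAction.Quotient.smul_coe, QuotientGroup.eq] at h
  have h' : q⁻¹ ∈ H := by simpa [smul_eq_mul] using h
  exact (Subgroup.inv_mem_iff H).mp h'

end Generic

variable (p : ℕ) [Fact p.Prime]

/-- **`LevelDictionary` (v1) is inhabited** at the witness `affWitness p` over its explicit chart `affChart p`,
with level graphs `{⋆} ⊔ Aff(ℤ_p)/Γ_j` carrying the (faithful-in-the-limit) translation action of
`Q = Aff(ℤ_p)` — see the module docstring. [cite: MochizukiSemiAnbd2006, Rmk. 2.2.1 p.24] -/
theorem nonempty_levelDictionary_affChart :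
    Nonempty (LevelDictionary.{0} (affWitness p) (affChart p)) := by
  classical
  -- the edgeless semi-graph on a type of vertices, and morphisms between such from maps of vertices
  let E : Type → SemiGraph.{0} := fun X => {
    Vertex := X
    Edge := PEmpty
    Branch := PEmpty
    edgeOf := PEmpty.elim
    abuts := PEmpty.elim
    two_branches := fun e => e.elim }
  let homOf : ∀ {X Y : Type}, (X → Y) → (E X ⟶ E Y) := fun f => {
    vertexMap := f
    edgeMap := PEmpty.elim
    branchMap := PEmpty.elim
    edgeOf_branchMap := fun b => b.elim
    branchMap_injOn := fun b => b.elim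
    abuts_branchMap := fun b => b.elim }
  have hext : ∀ {X Y : Type} (φ ψ : E X ⟶ E Y), φ.vertexMap = ψ.vertexMap → φ = ψ :=
    fun φ ψ h => SemiGraph.hom_ext φ ψ h (funext fun e => e.elim) (funext fun b => b.elim)
  -- the overgroup, the congruence subgroups, the level graphs
  let Q : Type := PadicAffine p
  let M : ℕ → Subgroup Q := PadicAffine.level p
  let L : ℕ → SemiGraph.{0} := fun j => E (Unit ⊕ (Q ⧸ M j))
  -- the translation action on the level graphs
  let τ : ∀ j, Q → (Unit ⊕ (Q ⧸ M j) → Unit ⊕ (Q ⧸ M j)) := fun j q => Sum.map id (q • ·)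
  have τ_one : ∀ j, τ j 1 = id := fun j => sumMap_smul_one (M j)
  have τ_mul : ∀ j (a b : Q), τ j (a * b) = τ j a ∘ τ j b := fun j a b => sumMap_smul_mul (M j) a b
  let ι : ∀ j, Q → Aut (L j) := fun j q =>
    { hom := homOf (τ j q)
      inv := homOf (τ j q⁻¹)
      hom_inv_id := hext _ _ (by
        change τ j q⁻¹ ∘ τ j q = id
        rw [← τ_mul, inv_mul_cancel, τ_one])
      inv_hom_id := hext _ _ (by
        change τ j q ∘ τ j q⁻¹ = id
        rw [← τ_mul, mul_inv_cancel, τ_one]) }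
  have ι_hom : ∀ j q, (ι j q).hom.vertexMap = τ j q := fun _ _ => rfl
  let ρ : ∀ j, Q →* Aut (L j) := fun j => MonoidHom.mk' (ι j) fun a b =>
    Iso.ext (hext _ _ (by
      change τ j (a * b) = τ j a ∘ τ j b
      exact τ_mul j a b))
  have ρ_hom : ∀ j (q : Q) x, (ρ j q).hom.vertexMap x = τ j q x := fun _ _ _ => rfl
  -- kernels: `q` acts trivially on `𝔾_j` iff `q ∈ Γ_j`
  have mem_ker_iff : ∀ j (q : Q), q ∈ (ρ j).ker ↔ q ∈ M j := fun j q => by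
    constructor
    · intro hq
      have h := congrArg (fun e : Aut (L j) => e.hom.vertexMap (Sum.inr ((1 : Q) : Q ⧸ M j))) hq
      change τ j q (Sum.inr _) = Sum.inr ((1 : Q) : Q ⧸ M j) at h
      exact mem_of_smul_mk_one_eq (M j) (Sum.inr.inj h)
    · intro hq
      rw [MonoidHom.mem_ker]
      refine Iso.ext (hext _ _ ?_)
      change τ j q = id
      funext x; rcases x with x | x
      · rfl
      · exact congrArg Sum.inr (smul_quotient_eq_self_of_mem (M j) hq x)
  -- transitions `Aff/Γ_j → Aff/Γ_i`
  let π : ∀ ⦃i j : ℕ⦄, i ≤ j → (Unit ⊕ (Q ⧸ M j) → Unit ⊕ (Q ⧸ M i)) := fun i j h =>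
    Sum.map id (Subgroup.quotientMapOfLE (level_antitone (p := p) h))
  have π_id : ∀ j, π (le_refl j) = id := fun j => sumMap_quotientMapOfLE_refl (M j)
  have π_comp : ∀ ⦃i j k : ℕ⦄ (hij : i ≤ j) (hjk : j ≤ k), π hij ∘ π hjk = π (hij.trans hjk) :=
    fun i j k hij hjk => sumMap_quotientMapOfLE_comp (level_antitone (p := p) hjk) (level_antitone (p := p) hij)
  have π_τ : ∀ ⦃i j : ℕ⦄ (h : i ≤ j) (q : Q), π h ∘ τ j q = τ i q ∘ π h :=
    fun i j h q => sumMap_quotientMapOfLE_smul (level_antitone (p := p) h) q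
  let X := affCovLevelDictionary p
  refine ⟨{
    toVerticialLevelData := X.toVerticialLevelData
    level := L
    finiteVertex := fun j => by
      haveI := PadicAffine.finite_quotient_level (p := p) j
      exact inferInstanceAs (Finite (Unit ⊕ (Q ⧸ M j)))
    finiteBranch := fun _ => inferInstanceAs (Finite PEmpty)
    quot := fun j => {
      vertexMap := fun _ => Sum.inl ()
      edgeMap := PEmpty.elim
      branchMap := PEmpty.elim
      edgeOf_branchMap := fun b => b.elim
      branchMap_injOn := fun b => b.elim
      abuts_branchMap := fun b => b.elim }
    quot_isImmersion := fun _ _ a => a.1.elim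
    levelAct := ρ
    act_quot := fun j g => SemiGraph.hom_ext _ _ (funext fun _ => rfl) (funext fun e => e.elim)
      (funext fun b => b.elim)
    levelTrans := fun i j h => homOf (π h)
    levelTrans_id := fun j => hext _ _ (π_id j)
    levelTrans_comp := fun i j k hij hjk => hext _ _ (π_comp hij hjk)
    levelTrans_act := fun i j h g => hext _ _ (by
      change π h ∘ τ j g = τ i g ∘ π h
      exact π_τ h g)
    trans_quot := fun i j h => SemiGraph.hom_ext _ _ (funext fun _ => rfl) (funext fun e => e.elim)
      (funext fun b => b.elim)
    levelProj := fun j => {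
      vertexMap := fun _ => PUnit.unit
      edgeMap := PEmpty.elim
      branchMap := PEmpty.elim
      edgeOf_branchMap := fun b => b.elim
      branchMap_injOn := fun b => b.elim
      abuts_branchMap := fun b => b.elim }
    levelProj_trans := fun i j h => SemiGraph.hom_ext _ _ (funext fun _ => rfl) (funext fun e => e.elim)
      (funext fun b => b.elim)
    Q := Q
    ιQ := MonoidHom.id Q
    ιQ_injective := fun _ _ h => h
    qAct := ρ
    qAct_ιQ := fun _ _ => rfl
    isOpen_ker_qAct := fun j => by
      have : ((ρ j).ker : Set Q) = (M j : Set Q) := Set.ext fun q => mem_ker_iff j q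
      rw [this]
      exact PadicAffine.isOpen_level (p := p) j
    ker_qAct_anti := fun i j h q hq => (mem_ker_iff i q).mpr (level_antitone (p := p) h ((mem_ker_iff j q).mp hq))
    ker_qAct_trivial := fun q hq => eq_one_of_forall_mem_level q fun j => (mem_ker_iff j q).mp (hq j)
    qAct_trans := fun i j h q x => by
      change (π h ∘ τ j q) x = (τ i q ∘ π h) x
      rw [π_τ h q]
    ψ := fun _ => MonoidHom.id Q
    ψ_injective := fun _ _ _ h => h
    ψ_continuous := fun _ => continuous_id
    rep := fun _ _ _ _ β => β.elim }⟩

/-- Hence some `𝒢` satisfying the hypotheses of [SemiAnbd] Thm. 3.7 has a chart of `π₁^temp(𝒢)` carrying a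
(v1) `LevelDictionary` — the structure's axioms are jointly satisfiable (universe `0`; `p = 2`).
[cite: MochizukiSemiAnbd2006, Rmk. 2.2.1 p.24] -/
theorem exists_levelDictionary :
    ∃ (𝒢 : ProfiniteSemiGraph.{0}) (_ : 𝒢.Thm37Hypotheses) (c : TemperedPiChart 𝒢),
      Nonempty (LevelDictionary.{0} 𝒢 c) :=
  ⟨@affWitness 2 ⟨Nat.prime_two⟩, @affWitness_thm37Hypotheses 2 ⟨Nat.prime_two⟩, @affChart 2 ⟨Nat.prime_two⟩,
    @nonempty_levelDictionary_affChart 2 ⟨Nat.prime_two⟩⟩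

end ProfiniteSemiGraph

end Literature.AnabelianGeometry.SemiGraphs

end
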